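import Literature.Geometry.Manifold.CircleProdComplexTangent
import Literature.Geometry.Manifold.CircleQuotientLift
import Literature.Geometry.Symplectic.CircleQuotientForms
import HarnessLib

/-!
# The cut space `N ×_{S¹} ℂ`: the associated bundle of a free circle action, as a manifold

Proofs companion of `OrigamiUnfolding.lean` (the named fact
`Literature.Geometry.Symplectic.exists_symplecticCutPieces_of_isOrigamiForm`, Cannas da
Silva–Guillemin–Pires, *Symplectic Origami*, IMRN 2011 = arXiv:0909.4065, Prop. 2.8), step
(S2)/(S3): the local model of a cut piece near its centre is the reduced space
`μ⁻¹(0)/S¹ ≅ Z ×_{S¹} ℂ` — the orbit space of the DIAGONAL circle action on `Z × ℂ` — containing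
the centre `B = Z/S¹` as the image of the zero section.  For a free smooth circle action on a
Hausdorff `k`-manifold `N` this file sets up, with the recharted product `ProdC k N`
(`CircleProdComplex.lean`) and the quotient-manifold theorem (`isManifold_circleQuotient`):

* `cutChartedSpace hθ hfree` — the slice-chart structure of `CutSpace k N := ProdC k N / S¹`,
  modelled on `ℝᵏ⁺¹`, a `C^∞` manifold (`isManifold_cutSpace`), Hausdorff, second countable /
  σ-compact / connected with `N`;
* `cutNormSq` — the invariant function `|w|²` descended to the cut space (`C^∞`,
  `contMDiff_cutNormSq`), the open discs `cutDisc δ = {|w|² < δ²}` about the zero section and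
  the compact "closed disc" images;
* `cutBase : CutSpace k N → N/S¹` — the bundle projection `[n, w] ↦ [n]` (`C^∞`);
* `cutZero : N/S¹ → CutSpace k N` — **the zero section** `[n] ↦ [n, 0]`: `C^∞`
  (`contMDiff_cutZero`), a closed topological embedding (`isClosedEmbedding_cutZero`, left
  inverse `cutBase`), with range `{|w|² = 0}` (`range_cutZero`), and an immersion
  (`injective_mfderiv_cutZero`: `d[n ↦ [n,0]]` kills only the orbit line).

Everything here is proved; the definitions are explicit constructions; no facts.

## References

* A. Cannas da Silva, V. Guillemin, A. R. Pires, *Symplectic Origami*, IMRN 2011 =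
  arXiv:0909.4065, §2.3, proof of Prop. 2.8. [CannasdasilvaGuilleminPires2010]
* J. M. Lee, *Introduction to Smooth Manifolds*, 2nd ed. (2012), Thm. 21.10, Example 21.31.
  [LeeSmoothManifolds2013]
-/

noncomputable section

open scoped Manifold ContDiff Topology
open Set Function Filter TopologicalSpace
open _root_.Topology
open Literature.Geometry.Manifold

namespace Literature.Geometry.Symplectic

variable {k : ℕ} {N : Type*} [TopologicalSpace N] [ChartedSpace (EuclideanSpace ℝ (Fin k)) N]
  [IsManifold (𝓡 k) ∞ N] [T2Space N] [MulAction Circle N]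
  (hθ : ContMDiff ((𝓡 1).prod (𝓡 k)) (𝓡 k) ∞ (fun x : Circle × N => x.1 • x.2))
  (hfree : ∀ (a : Circle) (x : N), a • x = x → a = 1)

/-! ### The cut space as a manifold -/

/-- **The cut space** `N ×_{S¹} ℂ = ProdC k N / S¹` (orbit space of the diagonal action).
[cite: CannasdasilvaGuilleminPires2010, §2.3] -/
abbrev CutSpace (k : ℕ) (N : Type*) [TopologicalSpace N] [ChartedSpace (EuclideanSpace ℝ (Fin k)) N]
    [MulAction Circle N] : Type _ :=
  CircleQuotient (ProdC k N)

/-- The orbit map `ProdC k N → CutSpace k N`, `(n, w) ↦ [n, w]`. [folklore] -/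
abbrev cutMk (n : N) (w : ℂ) : CutSpace k N := circleQuotientMk (ProdC.mk n w : ProdC k N)

omit [IsManifold (𝓡 k) ∞ N] [T2Space N] in
/-- `[a • n, a w] = [n, w]`. [folklore] -/
theorem cutMk_smul (a : Circle) (n : N) (w : ℂ) : cutMk (k := k) (a • n) ((a : ℂ) * w) = cutMk n w := by
  rw [cutMk, cutMk, ← ProdC.smul_mk, circleQuotientMk_smul]

omit [IsManifold (𝓡 k) ∞ N] [T2Space N] in
/-- Every point of the cut space is some `[n, w]`. [folklore] -/
theorem cutMk_surjective : ∀ q : CutSpace k N, ∃ (n : N) (w : ℂ), cutMk n w = q := by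
  intro q
  obtain ⟨p, rfl⟩ := circleQuotientMk_surjective q
  exact ⟨ProdC.fst p, ProdC.snd p, rfl⟩

omit [IsManifold (𝓡 k) ∞ N] [T2Space N] in
/-- `[n, w] = [n', w'] ↔ ∃ a, a • n' = n ∧ a w' = w`. [folklore] -/
theorem cutMk_eq_cutMk_iff {n n' : N} {w w' : ℂ} :
    cutMk (k := k) n w = cutMk n' w' ↔ ∃ a : Circle, a • n' = n ∧ (a : ℂ) * w' = w := by
  rw [cutMk, cutMk, circleQuotientMk_eq_iff]
  constructor
  · rintro ⟨a, ha⟩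
    rw [ProdC.smul_mk, ProdC.mk_eq_mk_iff] at ha
    exact ⟨a, ha.1, ha.2⟩
  · rintro ⟨a, h1, h2⟩
    exact ⟨a, by rw [ProdC.smul_mk, h1, h2]⟩

/-- **The slice-chart structure of the cut space**, modelled on `ℝᵏ⁺¹` (an abbreviation for
`circleQuotientChartedSpace` applied to the diagonal action). [cite: LeeSmoothManifolds2013, Thm. 21.10] -/
@[reducible]
def cutChartedSpace : ChartedSpace (EuclideanSpace ℝ (Fin (k + 1))) (CutSpace k N) :=
  circleQuotientChartedSpace (EuclideanSpace ℝ (Fin (k + 1))) (ProdC.contMDiff_smul_prodC hθ)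
    (ProdC.smul_eq_self_prodC hfree) (by rw [finrank_euclideanSpace_fin])

/-- **The cut space is a `C^∞` `(k+1)`-manifold.** [cite: LeeSmoothManifolds2013, Thm. 21.10] -/
theorem isManifold_cutSpace :
    letI := cutChartedSpace hθ hfree
    IsManifold (𝓡 (k + 1)) ∞ (CutSpace k N) :=
  isManifold_circleQuotient (F := EuclideanSpace ℝ (Fin (k + 1))) (ProdC.contMDiff_smul_prodC hθ)
    (ProdC.smul_eq_self_prodC hfree) (by rw [finrank_euclideanSpace_fin])

/-- The orbit map of the cut space is `C^∞`. [cite: LeeSmoothManifolds2013, Thm. 21.10] -/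
theorem contMDiff_circleQuotientMk_prodC :
    letI := cutChartedSpace hθ hfree
    ContMDiff (𝓡 (k + 2)) (𝓡 (k + 1)) ∞ (circleQuotientMk : ProdC k N → CutSpace k N) :=
  contMDiff_circleQuotientMk (ProdC.contMDiff_smul_prodC hθ) (ProdC.smul_eq_self_prodC hfree)
    (by rw [finrank_euclideanSpace_fin])

/-- `(n, w) ↦ [n, w]` is `C^∞` on `N × ℂ`. [folklore] -/
theorem contMDiff_cutMkUncurry :
    letI := cutChartedSpace hθ hfree
    ContMDiff ((𝓡 k).prod 𝓘(ℝ, ℂ)) (𝓡 (k + 1)) ∞ (fun x : N × ℂ => (cutMk x.1 x.2 : CutSpace k N)) := by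
  letI := cutChartedSpace hθ hfree
  exact (contMDiff_circleQuotientMk_prodC hθ hfree).comp ProdC.contMDiff_mkUncurry

omit [IsManifold (𝓡 k) ∞ N] [T2Space N] in
/-- The cut space is second countable when `N` is (and the action is continuous). [folklore] -/
theorem secondCountableTopology_cutSpace [SecondCountableTopology N]
    (hc : ContinuousSMul Circle (ProdC k N)) : SecondCountableTopology (CutSpace k N) :=
  secondCountableTopology_circleQuotient

omit [IsManifold (𝓡 k) ∞ N] [T2Space N] [MulAction Circle N] in
/-- `ProdC k N` is connected when `N` is. [folklore] -/
theorem connectedSpace_prodC [ConnectedSpace N] : ConnectedSpace (ProdC k N) :=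
  (ProdC.homeomorphProd (k := k) (N := N)).symm.surjective.connectedSpace
    (ProdC.homeomorphProd (k := k) (N := N)).symm.continuous

omit [IsManifold (𝓡 k) ∞ N] [T2Space N] in
/-- The cut space is connected when `N` is. [folklore] -/
theorem connectedSpace_cutSpace [ConnectedSpace N] : ConnectedSpace (CutSpace k N) :=
  haveI := connectedSpace_prodC (k := k) (N := N)
  connectedSpace_circleQuotient

/-! ### The radial function `|w|²` -/

omit [IsManifold (𝓡 k) ∞ N] [T2Space N] in
/-- `|w|²` is invariant under the diagonal action. [folklore] -/
theorem normSq_snd_smul (a : Circle) (p : ProdC k N) : ‖ProdC.snd (a • p)‖ ^ 2 = ‖ProdC.snd p‖ ^ 2 := by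
  rw [ProdC.norm_snd_smul]

/-- **The radial function** `[n, w] ↦ |w|²` on the cut space. [folklore] -/
def cutNormSq : CutSpace k N → ℝ :=
  circleQuotientLift (fun p : ProdC k N => ‖ProdC.snd p‖ ^ 2) normSq_snd_smul

omit [IsManifold (𝓡 k) ∞ N] [T2Space N] in
/-- `cutNormSq [n, w] = |w|²`. [folklore] -/
@[simp] theorem cutNormSq_cutMk (n : N) (w : ℂ) : cutNormSq (cutMk (k := k) n w) = ‖w‖ ^ 2 := rfl

omit [IsManifold (𝓡 k) ∞ N] [T2Space N] in
/-- `cutNormSq (π p) = |snd p|²`. [folklore] -/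
@[simp] theorem cutNormSq_mk (p : ProdC k N) : cutNormSq (circleQuotientMk p) = ‖ProdC.snd p‖ ^ 2 := rfl

omit [IsManifold (𝓡 k) ∞ N] [T2Space N] in
/-- `cutNormSq ≥ 0`. [folklore] -/
theorem cutNormSq_nonneg (q : CutSpace k N) : 0 ≤ cutNormSq q := by
  obtain ⟨n, w, rfl⟩ := cutMk_surjective q
  rw [cutNormSq_cutMk]
  positivity

omit [IsManifold (𝓡 k) ∞ N] [T2Space N] [MulAction Circle N] in
/-- `p ↦ |snd p|²` is `C^∞` on `ProdC k N`. [folklore] -/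
theorem contMDiff_normSq_snd_prodC [IsManifold (𝓡 k) ∞ N] :
    ContMDiff (𝓡 (k + 2)) 𝓘(ℝ, ℝ) ∞ (fun p : ProdC k N => ‖ProdC.snd p‖ ^ 2) :=
  (contDiff_norm_sq ℝ (n := ∞)).comp_contMDiff ProdC.contMDiff_snd

omit [IsManifold (𝓡 k) ∞ N] [T2Space N] in
/-- The radial function is continuous. [folklore] -/
theorem continuous_cutNormSq : Continuous (cutNormSq : CutSpace k N → ℝ) :=
  continuous_circleQuotientLift _ ((continuous_norm.pow 2).comp ProdC.continuous_snd)

/-- **The radial function is `C^∞`.** [folklore] -/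
theorem contMDiff_cutNormSq :
    letI := cutChartedSpace hθ hfree
    ContMDiff (𝓡 (k + 1)) 𝓘(ℝ, ℝ) ∞ (cutNormSq : CutSpace k N → ℝ) := by
  letI := cutChartedSpace hθ hfree
  exact contMDiff_circleQuotientLift (ProdC.contMDiff_smul_prodC hθ) (ProdC.smul_eq_self_prodC hfree)
    (by rw [finrank_euclideanSpace_fin]) _ contMDiff_normSq_snd_prodC

/-- **The open disc bundle** `{[n, w] : |w| < δ}` about the zero section. [folklore] -/
def cutDisc (δ : ℝ) : Opens (CutSpace k N) :=
  ⟨cutNormSq ⁻¹' Iio (δ ^ 2), (continuous_cutNormSq).isOpen_preimage _ isOpen_Iio⟩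

omit [IsManifold (𝓡 k) ∞ N] [T2Space N] in
/-- Membership in the disc bundle. [folklore] -/
theorem mem_cutDisc_iff {δ : ℝ} {q : CutSpace k N} : q ∈ cutDisc δ ↔ cutNormSq q < δ ^ 2 :=
  Iff.rfl

omit [IsManifold (𝓡 k) ∞ N] [T2Space N] in
/-- `[n, w] ∈ cutDisc δ ↔ |w| < δ` for `δ > 0`. [folklore] -/
theorem cutMk_mem_cutDisc_iff {δ : ℝ} (hδ : 0 < δ) {n : N} {w : ℂ} :
    cutMk (k := k) n w ∈ cutDisc δ ↔ ‖w‖ < δ := by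
  rw [mem_cutDisc_iff, cutNormSq_cutMk]
  exact pow_lt_pow_iff_left₀ (norm_nonneg _) hδ.le two_ne_zero

omit [IsManifold (𝓡 k) ∞ N] [T2Space N] in
/-- The image of `N × closedBall 0 r` is compact when `N` is. [folklore] -/
theorem isCompact_image_cutMk_closedBall [CompactSpace N] (r : ℝ) :
    IsCompact ((fun x : N × ℂ => (cutMk x.1 x.2 : CutSpace k N)) ''
      (univ ×ˢ Metric.closedBall (0 : ℂ) r)) := by
  refine (isCompact_univ.prod (isCompact_closedBall (0 : ℂ) r)).image ?_
  exact continuous_circleQuotientMk.comp ProdC.continuous_mkUncurry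

omit [IsManifold (𝓡 k) ∞ N] [T2Space N] in
/-- Points with `|w|² ≤ r²` lie in the image of `N × closedBall 0 r` (`r ≥ 0`). [folklore] -/
theorem mem_image_cutMk_closedBall_of_cutNormSq_le {r : ℝ} (hr : 0 ≤ r) {q : CutSpace k N}
    (hq : cutNormSq q ≤ r ^ 2) :
    q ∈ (fun x : N × ℂ => (cutMk x.1 x.2 : CutSpace k N)) ''
      (univ ×ˢ Metric.closedBall (0 : ℂ) r) := by
  obtain ⟨n, w, rfl⟩ := cutMk_surjective q
  rw [cutNormSq_cutMk] at hq
  refine ⟨(n, w), ⟨mem_univ _, ?_⟩, rfl⟩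
  rw [Metric.mem_closedBall, dist_zero_right]
  exact (pow_le_pow_iff_left₀ (norm_nonneg _) hr two_ne_zero).1 hq

/-! ### The bundle projection and the zero section -/

omit [IsManifold (𝓡 k) ∞ N] [T2Space N] in
/-- `p ↦ [fst p]` is invariant. [folklore] -/
theorem circleQuotientMk_fst_smul (a : Circle) (p : ProdC k N) :
    circleQuotientMk (ProdC.fst (a • p)) = circleQuotientMk (ProdC.fst p) := by
  rw [ProdC.fst_smul, circleQuotientMk_smul]

/-- **The bundle projection** `[n, w] ↦ [n]` from the cut space to `N/S¹`. [folklore] -/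
def cutBase : CutSpace k N → CircleQuotient N :=
  circleQuotientLift (fun p : ProdC k N => circleQuotientMk (ProdC.fst p)) circleQuotientMk_fst_smul

omit [IsManifold (𝓡 k) ∞ N] [T2Space N] in
/-- `cutBase [n, w] = [n]`. [folklore] -/
@[simp] theorem cutBase_cutMk (n : N) (w : ℂ) : cutBase (cutMk (k := k) n w) = circleQuotientMk n := rfl

omit [IsManifold (𝓡 k) ∞ N] [T2Space N] in
/-- The bundle projection is continuous. [folklore] -/
theorem continuous_cutBase : Continuous (cutBase : CutSpace k N → CircleQuotient N) :=
  continuous_circleQuotientLift _ (continuous_circleQuotientMk.comp ProdC.continuous_fst)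

/-- **The bundle projection is `C^∞`** (for the slice structures with any model `F` of `N/S¹`).
[cite: LeeSmoothManifolds2013, Thm. 4.30] -/
theorem contMDiff_cutBase {F : Type*} [NormedAddCommGroup F] [NormedSpace ℝ F]
    [FiniteDimensional ℝ F] (hF : Module.finrank ℝ F + 1 = k) :
    letI := cutChartedSpace hθ hfree
    letI := circleQuotientChartedSpace F hθ hfree hF
    ContMDiff (𝓡 (k + 1)) 𝓘(ℝ, F) ∞ (cutBase : CutSpace k N → CircleQuotient N) := by
  letI := cutChartedSpace hθ hfree
  letI := circleQuotientChartedSpace F hθ hfree hF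
  exact contMDiff_circleQuotientLift (ProdC.contMDiff_smul_prodC hθ)
    (ProdC.smul_eq_self_prodC hfree) (by rw [finrank_euclideanSpace_fin]) _
    ((contMDiff_circleQuotientMk hθ hfree hF).comp ProdC.contMDiff_fst)

omit [IsManifold (𝓡 k) ∞ N] [T2Space N] in
/-- `n ↦ [n, 0]` is invariant. [folklore] -/
theorem cutMk_zero_smul (a : Circle) (n : N) : cutMk (k := k) (a • n) 0 = cutMk n 0 := by
  have h := cutMk_smul (k := k) a n 0
  rwa [mul_zero] at h

/-- **The zero section** `[n] ↦ [n, 0]` of the cut space (the centre `B ↪ M₀` of Prop. 2.8).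
[cite: CannasdasilvaGuilleminPires2010, Prop. 2.8] -/
def cutZero : CircleQuotient N → CutSpace k N :=
  circleQuotientLift (fun n : N => cutMk n 0) cutMk_zero_smul

omit [IsManifold (𝓡 k) ∞ N] [T2Space N] in
/-- `cutZero [n] = [n, 0]`. [folklore] -/
@[simp] theorem cutZero_mk (n : N) : cutZero (circleQuotientMk n) = cutMk (k := k) n 0 := rfl

omit [IsManifold (𝓡 k) ∞ N] [T2Space N] in
/-- `cutBase ∘ cutZero = id`. [folklore] -/
theorem cutBase_cutZero (b : CircleQuotient N) : cutBase (cutZero (k := k) b) = b := by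
  obtain ⟨n, rfl⟩ := circleQuotientMk_surjective b
  rfl

omit [IsManifold (𝓡 k) ∞ N] [T2Space N] in
/-- The zero section is injective. [folklore] -/
theorem injective_cutZero : Injective (cutZero : CircleQuotient N → CutSpace k N) :=
  (LeftInverse.injective (g := cutBase) cutBase_cutZero)

omit [IsManifold (𝓡 k) ∞ N] [T2Space N] in
/-- The zero section is continuous. [folklore] -/
theorem continuous_cutZero : Continuous (cutZero : CircleQuotient N → CutSpace k N) :=
  continuous_circleQuotientLift _
    (continuous_circleQuotientMk.comp (ProdC.continuous_mkUncurry.comp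
      (continuous_id.prodMk continuous_const)))

omit [IsManifold (𝓡 k) ∞ N] in
/-- **The zero section is a closed topological embedding** (it has the continuous left inverse
`cutBase`; the diagonal action is assumed continuous, for the Hausdorff property of the cut space).
[folklore] -/
theorem isClosedEmbedding_cutZero (hc : ContinuousSMul Circle (ProdC k N)) :
    IsClosedEmbedding (cutZero : CircleQuotient N → CutSpace k N) :=
  Function.LeftInverse.isClosedEmbedding cutBase_cutZero continuous_cutBase continuous_cutZero

omit [IsManifold (𝓡 k) ∞ N] [T2Space N] in
/-- **The range of the zero section is `{|w|² = 0}`.** [folklore] -/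
theorem range_cutZero : range (cutZero : CircleQuotient N → CutSpace k N) = cutNormSq ⁻¹' {0} := by
  ext q
  constructor
  · rintro ⟨b, rfl⟩
    obtain ⟨n, rfl⟩ := circleQuotientMk_surjective b
    simp
  · intro hq
    obtain ⟨n, w, rfl⟩ := cutMk_surjective q
    simp only [mem_preimage, cutNormSq_cutMk, mem_singleton_iff, sq_eq_zero_iff, norm_eq_zero] at hq
    subst hq
    exact ⟨circleQuotientMk n, rfl⟩

omit [IsManifold (𝓡 k) ∞ N] [T2Space N] in
/-- A point is off the zero section iff `|w|² ≠ 0`. [folklore] -/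
theorem not_mem_range_cutZero_iff {q : CutSpace k N} :
    q ∉ range (cutZero : CircleQuotient N → CutSpace k N) ↔ cutNormSq q ≠ 0 := by
  rw [range_cutZero]
  rfl

/-- **The zero section is `C^∞`.** [cite: LeeSmoothManifolds2013, Thm. 4.30] -/
theorem contMDiff_cutZero {F : Type*} [NormedAddCommGroup F] [NormedSpace ℝ F]
    [FiniteDimensional ℝ F] (hF : Module.finrank ℝ F + 1 = k) :
    letI := cutChartedSpace hθ hfree
    letI := circleQuotientChartedSpace F hθ hfree hF
    ContMDiff 𝓘(ℝ, F) (𝓡 (k + 1)) ∞ (cutZero : CircleQuotient N → CutSpace k N) := by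
  letI := cutChartedSpace hθ hfree
  haveI := isManifold_cutSpace hθ hfree
  letI := circleQuotientChartedSpace F hθ hfree hF
  exact contMDiff_circleQuotientLift hθ hfree hF _
    ((contMDiff_cutMkUncurry hθ hfree).comp (contMDiff_id.prodMk contMDiff_const))

/-- **The zero section is an immersion**: its differential at `[n]` is injective — the
differential of `n ↦ [n, 0]` kills `v` only if `L (v, 0)` is a multiple of the fundamental vector
`L (X_n, 0)` of the diagonal action, i.e. only if `v ∈ ℝ X_n = ker dπ_n`.
[cite: CannasdasilvaGuilleminPires2010, Prop. 2.8] -/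
theorem injective_mfderiv_cutZero {F : Type*} [NormedAddCommGroup F] [NormedSpace ℝ F]
    [FiniteDimensional ℝ F] (hF : Module.finrank ℝ F + 1 = k) (n : N) :
    letI := cutChartedSpace hθ hfree
    letI := circleQuotientChartedSpace F hθ hfree hF
    Injective (mfderiv 𝓘(ℝ, F) (𝓡 (k + 1)) (cutZero : CircleQuotient N → CutSpace k N)
      (circleQuotientMk n)) := by
  letI := cutChartedSpace hθ hfree
  haveI := isManifold_cutSpace hθ hfree
  letI := circleQuotientChartedSpace F hθ hfree hF
  have hs : ContMDiff (𝓡 k) (𝓡 (k + 1)) ∞ (fun n : N => (cutMk n 0 : CutSpace k N)) :=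
    (contMDiff_cutMkUncurry hθ hfree).comp (contMDiff_id.prodMk contMDiff_const)
  refine injective_mfderiv_circleQuotientLift hθ hfree hF cutMk_zero_smul hs.contMDiffAt ?_
  intro v hv
  -- `d(π ∘ (·, 0)) v = dπ (L (v, 0)) = 0`, so `L (v, 0) = c • L (X, 0)`
  have hsec : ContMDiff (𝓡 k) (𝓡 (k + 2)) ∞ (fun n : N => (ProdC.mk n 0 : ProdC k N)) :=
    ContMDiff.prodC_mk contMDiff_id contMDiff_const
  have hd : mfderiv (𝓡 k) (𝓡 (k + 1)) (fun n : N => (cutMk n 0 : CutSpace k N)) n v =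
      mfderiv (𝓡 (k + 2)) (𝓡 (k + 1)) (circleQuotientMk : ProdC k N → CutSpace k N) (ProdC.mk n 0)
        (mfderiv (𝓡 k) (𝓡 (k + 2)) (fun n : N => (ProdC.mk n 0 : ProdC k N)) n v) := by
    have h := mfderiv_comp n
      (((contMDiff_circleQuotientMk_prodC hθ hfree) (ProdC.mk n 0)).mdifferentiableAt (by simp))
      ((hsec n).mdifferentiableAt (by simp))
    exact congrArg (fun L => L v) h
  have hsecd : mfderiv (𝓡 k) (𝓡 (k + 2)) (fun n : N => (ProdC.mk n 0 : ProdC k N)) n v =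
      ProdC.tangentLift k v 0 := by
    have H : HasMFDerivAt (𝓡 k) (𝓡 (k + 2)) (fun n : N => (ProdC.mk n 0 : ProdC k N)) n
        ((prodCModelIso k : (EuclideanSpace ℝ (Fin k) × ℂ) →L[ℝ]
          EuclideanSpace ℝ (Fin (k + 2))).comp
          ((ContinuousLinearMap.id ℝ (TangentSpace (𝓡 k) n)).prod 0)) :=
      ProdC.hasMFDerivAt_prodC_mk (N := N) (x := n) (hasMFDerivAt_id (I := 𝓡 k) n)
        (hasMFDerivAt_const (I := 𝓡 k) (I' := 𝓘(ℝ, ℂ)) (0 : ℂ) n)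
    rw [H.mfderiv]
    rfl
  rw [hd, hsecd] at hv
  obtain ⟨c, hc⟩ := exists_smul_of_mfderiv_circleQuotientMk_eq_zero
    (ProdC.contMDiff_smul_prodC hθ) (ProdC.smul_eq_self_prodC hfree)
    (by rw [finrank_euclideanSpace_fin]) (ProdC.mk n 0) _ hv
  rw [circleFundVec_eq, ProdC.mfderiv_circleOrbit_prodC hθ, mul_zero, ← circleFundVec_eq] at hc
  have h1 := congrArg (mfderiv (𝓡 (k + 2)) (𝓡 k) ProdC.fst (ProdC.mk n 0 : ProdC k N)) hc
  rw [map_smul, ProdC.mfderiv_fst_tangentLift, ProdC.mfderiv_fst_tangentLift] at h1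
  have h1' : v = c • circleFundVec n := h1
  rw [h1', map_smul, circleFundVec_eq, mfderiv_circleQuotientMk_apply_orbit hθ hfree hF n, smul_zero]

end Literature.Geometry.Symplectic

end
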